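import Summits.ResolutionOfSingularities.ResolutionOfSingularities.Theorems.DepthLawAlgebra
import HarnessLib

/-!
# DepthLaw — decomp-res node «AntelopeCut» (lens-4 g27, critic row 157), tree file 2/5 of the node

Content VERBATIM from the decomp-res lens-4 g27 node `HOME/decomp-res-lens-4/g27/AntelopeCut.lean` (pin de2834f0 =
`parts/AntelopeCut-g27-de2834f0.lean`,
1 885 l; HOME = run/shared/lean/pub/decomp-res): its NEW PART ONLY, §71–§73 = `parts/part_new-g27-7bf105d9.lean` (40
declarations) — the carried block
l. 106–1279 (= g26/CompanionCut.lean ll. 85–1258 VERBATIM, machine diff empty) is ALREADY in the tree as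
`Theorems/CompanionAlgebra` · `CompanionHasse` ·
`CompanionPresentation` · `CompanionTransport` · `CompanionTowers` · `CompanionCutCells` ·
`MaxContactCutCompanionCut` and is imported, not repeated.
Critic: CRITIC-LEDGER row 157 (2026-08-31T00:29:39Z): DECIDED 0 · MAP 0 — BOOKED («true kernel bricks — land as
support»; the depth / height /
dimension-count axis was priced once at row 151).  Landing orders INBOX :558/:560 (lens-4 g27 landing note +
erratum, split per NEXT-g28 §4) and :566
(critic): `--kind proof --supports stmt-ResolutionOfSingularities-28338`, namespace `…Theorems.HugValuationCut`,
canonical headers; files of the node: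
`DepthLawAlgebra` · `DepthLaw` (§71 + §71b) · `AntelopeDictionary` (§72) · `DepthCutCells` (§73, cone-free cells) ·
`MaxContactCutDepthCut` (the four §73 corollaries GIVEN
31571 `MaxContactCut.NoContactHuggingTowers` BY NAME — in the Theses cone).  Aside bookkeeping (row 157 / INBOX
:566): ONE successor aside on the lens-4
column, `NoWildShallowCompanionKangarooTowers` (home `DepthCutCells`), SUPERSEDING g26's
`NoWildCompanionKangarooTowers` / g25's route aside
`HCNoWildKangarooOffDoublePointTowers` (exact hyp-free `noWildCompanionKangarooTowers_iff_g27`); the decided cell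
`NoWildDeepCompanionKangarooTowers` is a
THEOREM (`noWildDeepCompanionKangarooTowers_holds`) and is not filed; `HeightLaw.no_doublePointTower` stays.

## This file

§71 second part + §71b (NEW, KERNEL): THE DEPTH LAWS at scheme level and along forced towers — `section
DepthTransport` (scheme level: **`exists_generization_of_deepPoint`** — at a principal weak-contact stage of weight
`w` and depth `N`, `N ≥ 2w` ⟹ no successor of ring dimension `≥ 3`, `N ≥ 2w − 1 ∧ w ≥ 2` ⟹ none of ring dimension `≥
4`), `section DepthTowers` (`DeepPointAt`, `DimThreeAt`, `DeepTower`, `doublePointAt_iff_deepPointAt : DoublePointAt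
↔ DeepPointAt 2 3` (`Iff.rfl`: g25's weight-two height law is (L-B) at `w = 2`), `no_successor_of_deepPointAt`, the
forced-tower depth bound **`no_deepTower`**, `deepTower_of_doublePointTower`, `no_doublePointTower_of_depthLaw`).
Imports `DepthLawAlgebra` (hence `HeightCutCells`: the `DoublePointAt` / `DimFourAt` / `DoublePointTower` / `ForcedTower` API).

[WRITER NOTE (decomp-res writer g9): file split only (tree files ≤ 400 lines); namespace, universe, sections,
section variables and every declaration
exactly as in the lens (the node's global `set_option` and the `open …Theses` line live only in the wiring file).]

(Sources: Hauser2010Kangaroo (arXiv:0811.4151 §C); Moh1987; HauserPerlega2019 §1; Hauser2024 PRIMS 60 pp. 788, 798;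
Cossart2011 III.2 (doi:10.4310/ajm.2011.v15.n3.a3); CossartPiltant2008 §2; CossartPiltant2019 Prop. 2.50;
Giraud1975; Hironaka1970Additive.)
-/

noncomputable section

open CategoryTheory AlgebraicGeometry IsLocalRing
open Literature.AlgebraicGeometry.Resolution
open Summit.ResolutionOfSingularities.ResolutionOfSingularities.Theorems
open WeakOrderReduction ForcedTowerClasses DivergentTowerClasses MonomialTowerClasses
open HugDimensionClasses HugDimensionKernels SurfaceShadowClasses SurfaceShadowKernels
open NearPointCut (SingularClass)
open AbsoluteContactClasses (IsAbsContactAt SepResidueAt diffIdeal_restrict_le stalkMap_comp_toStalk_eq_stalkHom)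
open scoped BigOperators

namespace Summit.ResolutionOfSingularities.ResolutionOfSingularities.Theorems.HugValuationCut

section DepthTransport

universe uV
variable {X X' : Scheme.{uV}} {π : X' ⟶ X} {C : X.IdealSheafData}

/-- **THE DEPTH LAWS, SCHEME LEVEL (KERNEL, PROVED — every field, every characteristic, every weight).**  `π : X' → X` the
blow-up of a regular locally Noetherian `X` at the (reduced, closed) point `x = π y`, `X'` regular; the weight-`w` stalk `𝓘_x`
PRINCIPAL MODULO `𝔪^{2w}` with a WEAK-CONTACT presentation of DEPTH `N` (`f ∈ 𝓘_x ⊆ (f) + 𝔪_x^{2w}`, `f − c z^w ∈ 𝔪_x^N`,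
`c` a unit, `z ∈ 𝔪_x ∖ 𝔪_x²`, `H_x = (z)` any germ ideal, `1 ≤ w`, `w + 1 ≤ N`); `M' = (𝓘', w)` the controlled transform
marked at `w`.  If `y ∈ supp M'` and EITHER `N ≥ 2w` and `dim 𝒪_{X',y} ≥ 3` (LAW A) OR `N ≥ 2w − 1` and `dim 𝒪_{X',y} ≥ 4`
(LAW B), then `y` has a PROPER GENERIZATION in `supp M'`. (Sources: Hauser2010Kangaroo §B–C and Moh1987 for the depth
`|r| + shade`; Krull's height theorem; the statement appears to be new — g25's `exists_generization_of_doublePoint` is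
`w = 2, N = 3`.) -/
theorem exists_generization_of_deepPoint (hπ : IsBlowup π C) [IsLocallyNoetherian X] [IsLocallyNoetherian X']
    (hX : Scheme.IsRegular X) (hX' : Scheme.IsRegular X') (hCreg : Scheme.IsRegular C.subscheme)
    (I H : X.IdealSheafData) (y : X')
    (hcl : IsClosed ({π y} : Set X)) (hpt : (C.support : Set X) = {π y})
    {w N : ℕ} (hw : 1 ≤ w) (hN : w + 1 ≤ N)
    {f z c : X.presheaf.stalk (π y)} (hfI : f ∈ stalkIdeal I (π y))
    (hIf : stalkIdeal I (π y) ≤ Ideal.span {f} ⊔ maximalIdeal _ ^ (2 * w))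
    (hH : stalkIdeal H (π y) = Ideal.span {z}) (hz1 : z ∈ maximalIdeal _) (hz2 : z ∉ maximalIdeal _ ^ 2)
    (hc : IsUnit c) (hfz : f - c * z ^ w ∈ maximalIdeal _ ^ N)
    (hcase : (2 * w ≤ N ∧ (3 : WithBot ℕ∞) ≤ ringKrullDim (X'.presheaf.stalk y)) ∨
      (2 * w ≤ N + 1 ∧ (4 : WithBot ℕ∞) ≤ ringKrullDim (X'.presheaf.stalk y)))
    (M' : MarkedIdeal X') (hM'I : M'.ideal = controlledTransform π C I w) (hM'μ : M'.mult = w)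
    (hy : y ∈ M'.support) :
    ∃ ζ : X', ζ ⤳ y ∧ ζ ≠ y ∧ ζ ∈ M'.support := by
  haveI : IsRegularLocalRing (X.presheaf.stalk (π y)) := hX _
  haveI : IsRegularLocalRing (X'.presheaf.stalk y) := hX' _
  have hCst : stalkIdeal C (π y) = maximalIdeal _ := by
    rw [eq_vanishingIdeal_support_of_isRegular C hCreg]
    apply stalkIdeal_vanishingIdeal_eq_maximalIdeal_of_closure_eq
    rw [hpt, hcl.closure_eq]
  obtain ⟨𝔷, z', hE, hnzd, hzz', ht2⟩ := point_round_chart_sq hπ y hCst hz1 hz2 hH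
  set σ := (π.stalkMap y).hom with hσ
  set t := σ 𝔷 with ht
  -- the exceptional ideal at `y` is `(t) = 𝔪_x · 𝒪_{X',y}`
  have hEm : (maximalIdeal (X.presheaf.stalk (π y))).map σ = Ideal.span {t} := by
    rw [← hCst, ← stalkIdeal_comap_eq_map_stalkMap, hE]
  -- `f ∈ 𝔪_x^w`, so `π^* f = w₀ · t^w`
  have hfw : f ∈ maximalIdeal (X.presheaf.stalk (π y)) ^ w := by
    have h1 : c * z ^ w ∈ maximalIdeal _ ^ w := Ideal.mul_mem_left _ _ (Ideal.pow_mem_pow hz1 w)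
    have h2 : f = (f - c * z ^ w) + c * z ^ w := by ring
    rw [h2]
    exact add_mem (Ideal.pow_le_pow_right (by omega) hfz) h1
  have hσf : σ f ∈ Ideal.span {t ^ w} := by
    have hm : σ f ∈ (maximalIdeal _ ^ w).map σ := Ideal.mem_map_of_mem _ hfw
    rwa [Ideal.map_pow, hEm, Ideal.span_singleton_pow] at hm
  obtain ⟨w₀, hw₀⟩ := Ideal.mem_span_singleton'.mp hσf
  -- the colon formula for the controlled transform
  have hI' : stalkIdeal (controlledTransform π C I w) y =
      Submodule.colon ((stalkIdeal I (π y)).map σ) {t ^ w} := by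
    rw [hπ.stalkIdeal_controlledTransform I w y, stalkIdeal_comap_eq_map_stalkMap, hE,
      Ideal.span_singleton_pow, Submodule.colon_span]
  have hw₀I' : w₀ ∈ stalkIdeal (controlledTransform π C I w) y := by
    rw [hI', Submodule.mem_colon_singleton, smul_eq_mul, hw₀]
    exact Ideal.mem_map_of_mem _ hfI
  -- `π^*(f − c z^w) = b · t^N`
  have hσr : σ (f - c * z ^ w) ∈ Ideal.span {t ^ N} := by
    have hm : σ (f - c * z ^ w) ∈ (maximalIdeal _ ^ N).map σ := Ideal.mem_map_of_mem _ hfz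
    rwa [Ideal.map_pow, hEm, Ideal.span_singleton_pow] at hm
  obtain ⟨b, hb⟩ := Ideal.mem_span_singleton'.mp hσr
  -- cancel `t^w`: the new tail is `t^(N − w) · b`
  have hkey : w₀ - σ c * z' ^ w = t ^ (N - w) * b := by
    have h1 : t ^ w * (w₀ - σ c * z' ^ w) = t ^ w * (t ^ (N - w) * b) := by
      have e1 : σ (f - c * z ^ w) = σ f - σ c * (t * z') ^ w := by rw [map_sub, map_mul, map_pow, hzz']
      have eN : t ^ N = t ^ w * t ^ (N - w) := by rw [← pow_add]; congr 1; omega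
      calc t ^ w * (w₀ - σ c * z' ^ w) = w₀ * t ^ w - σ c * (t * z') ^ w := by ring
        _ = σ (f - c * z ^ w) := by rw [e1, hw₀]
        _ = b * t ^ N := hb.symm
        _ = t ^ w * (t ^ (N - w) * b) := by rw [eN]; ring
    exact (mul_cancel_left_mem_nonZeroDivisors (pow_mem hnzd w)).mp h1
  -- `t ∈ 𝔪_y`, `w₀ ∈ 𝓘'_y ⊆ 𝔪_y^w`, `z' ∈ 𝔪_y`
  have htm : t ∈ maximalIdeal (X'.presheaf.stalk y) := by
    have h1 : t ∈ (maximalIdeal (X.presheaf.stalk (π y))).map σ := by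
      rw [hEm]; exact Ideal.mem_span_singleton_self t
    have hle : (maximalIdeal (X.presheaf.stalk (π y))).map σ ≤ maximalIdeal (X'.presheaf.stalk y) :=
      Ideal.map_le_iff_le_comap.mpr fun a ha => Ideal.mem_comap.mpr (map_nonunit σ a ha)
    exact hle h1
  have hI'w : stalkIdeal (controlledTransform π C I w) y ≤ maximalIdeal _ ^ w := by
    have h1 := (MarkedIdeal.mem_support_iff M' y).mp hy
    rwa [hM'I, hM'μ] at h1
  have hw₀w : w₀ ∈ maximalIdeal (X'.presheaf.stalk y) ^ w := hI'w hw₀I'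
  have hcu : IsUnit (σ c) := hc.map σ
  have htNw : t ^ (N - w) * b ∈ maximalIdeal (X'.presheaf.stalk y) := by
    refine Ideal.mul_mem_right _ _ ?_
    have eN : N - w = (N - w - 1) + 1 := by omega
    rw [eN, pow_succ]
    exact Ideal.mul_mem_left _ _ htm
  have hz'm : z' ∈ maximalIdeal (X'.presheaf.stalk y) := by
    have h1 : w₀ - t ^ (N - w) * b ∈ maximalIdeal _ :=
      sub_mem (Ideal.pow_le_self (by omega) hw₀w) htNw
    have e : w₀ - t ^ (N - w) * b = σ c * z' ^ w := by rw [← hkey]; ring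
    rw [e] at h1
    exact Ideal.IsPrime.mem_of_pow_mem inferInstance w ((Ideal.unit_mul_mem_iff_mem _ hcu).mp h1)
  -- THE COUNT: a prime `P ≠ 𝔪_y` with `t ∈ P`, `w₀ ∈ P^w`
  obtain ⟨P, hP, hPne, htP, hw₀P⟩ : ∃ P : Ideal (X'.presheaf.stalk y), P.IsPrime ∧ P ≠ maximalIdeal _ ∧
      t ∈ P ∧ w₀ ∈ P ^ w := by
    rcases hcase with ⟨h2w, hdim3⟩ | ⟨h2w1, hdim4⟩
    · exact exists_prime_ne_maximalIdeal_of_deepTail hkey (by omega) htm hz'm hdim3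
    · by_cases h2w : 2 * w ≤ N
      · have hdim3 : (3 : WithBot ℕ∞) ≤ ringKrullDim (X'.presheaf.stalk y) :=
          le_trans (by exact_mod_cast (by norm_num : (3 : ℕ) ≤ 4)) hdim4
        exact exists_prime_ne_maximalIdeal_of_deepTail hkey (by omega) htm hz'm hdim3
      · -- `N = 2w − 1`: the cofactor `b` is not a unit — else `t^{w−1} ∈ 𝔪_y^w`, so `t ∈ 𝔪_y²` (order is a valuation)
        have hNw : N - w = w - 1 := by omega
        have hbm : b ∈ maximalIdeal (X'.presheaf.stalk y) := by
          by_contra hbu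
          rw [mem_maximalIdeal, mem_nonunits_iff, not_not] at hbu
          have h1 : t ^ (N - w) * b ∈ maximalIdeal _ ^ w := by
            rw [← hkey]
            exact sub_mem hw₀w (Ideal.mul_mem_left _ _ (Ideal.pow_mem_pow hz'm w))
          have h2 : t ^ (w - 1) ∈ maximalIdeal _ ^ ((w - 1) + 1) := by
            have ew : (w - 1) + 1 = w := by omega
            rw [ew, ← hNw]
            have e : t ^ (N - w) = t ^ (N - w) * b * ↑hbu.unit⁻¹ := by
              rw [mul_assoc, IsUnit.mul_val_inv, mul_one]
            rw [e]; exact Ideal.mul_mem_right _ _ h1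
          exact ht2 (mem_sq_of_pow_mem_pow_succ (by omega) h2)
        exact exists_prime_ne_maximalIdeal_of_nearDeepTail hkey (by omega) htm hz'm hbm hdim4
  haveI := hP
  -- every element of `𝓘'_y` is `a · w₀ + e · t^w`, hence lies in `P^w`
  have hI'P : stalkIdeal (controlledTransform π C I w) y ≤ P ^ w := by
    intro v hv
    rw [hI', Submodule.mem_colon_singleton, smul_eq_mul] at hv
    have hle : (stalkIdeal I (π y)).map σ ≤ Ideal.span {σ f} ⊔ Ideal.span {t ^ (2 * w)} := by
      refine (Ideal.map_mono hIf).trans (le_of_eq ?_)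
      rw [Ideal.map_sup, Ideal.map_span, Set.image_singleton, Ideal.map_pow, hEm, Ideal.span_singleton_pow]
    obtain ⟨u, hu, u', hu', huu⟩ := Submodule.mem_sup.mp (hle hv)
    obtain ⟨a, rfl⟩ := Ideal.mem_span_singleton'.mp hu
    obtain ⟨e, rfl⟩ := Ideal.mem_span_singleton'.mp hu'
    have e2 : t ^ (2 * w) = t ^ w * t ^ w := by rw [← pow_add, two_mul]
    have h1 : (a * w₀ + e * t ^ w) * t ^ w = v * t ^ w := by
      rw [← huu, ← hw₀, e2]; ring
    have h2 : a * w₀ + e * t ^ w = v := (mul_cancel_right_mem_nonZeroDivisors (pow_mem hnzd w)).mp h1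
    rw [← h2]
    exact add_mem (Ideal.mul_mem_left _ _ hw₀P) (Ideal.mul_mem_left _ _ (Ideal.pow_mem_pow htP w))
  exact exists_specializes_ne_mem_support M' y P hPne (by rw [hM'I, hM'μ]; exact hI'P)

end DepthTransport

section DepthTowers

variable {k : Type} [Field k]

/-! ### §71b  The laws along lens-4's forced towers -/

/-- **A WEAK-CONTACT POINT OF WEIGHT `w`, PRINCIPAL MODULO `𝔪^{2w}`, OF DEPTH ≥ `N`** at `y` for `𝓘`: `f ∈ 𝓘_y ⊆ (f)
+ 𝔪_y^{2w}`,
`z ∈ 𝔪_y ∖ 𝔪_y²`, `c` a unit, `f − c·z^w ∈ 𝔪_y^N` — «exceptional order + residual order of the weight-`w` contact ≥ N» in one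
presentation (Hauser: `f = z^w + y^r g`, `N = |r| + shade`).  `DeepPointAt 2 3 = DoublePointAt` (g25). (Sources:
Hauser2010Kangaroo
§B–C; Moh1987; HauserPerlega2019 §2 «residual order».) -/
def DeepPointAt {Y : Scheme.{0}} (w N : ℕ) (I : Y.IdealSheafData) (y : Y) : Prop :=
  ∃ f ∈ stalkIdeal I y, stalkIdeal I y ≤ Ideal.span {f} ⊔ maximalIdeal (Y.presheaf.stalk y) ^ (2 * w) ∧
    ∃ z ∈ maximalIdeal (Y.presheaf.stalk y), z ∉ maximalIdeal (Y.presheaf.stalk y) ^ 2 ∧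
      ∃ c : Y.presheaf.stalk y, IsUnit c ∧ f - c * z ^ w ∈ maximalIdeal (Y.presheaf.stalk y) ^ N

/-- **stage `i` is a point of RING DIMENSION ≥ 3** (`dim 𝒪_{X_i, x_i} ≥ 3`: a closed point of a threefold or fourfold component
under `IsBase`). -/
def DimThreeAt (T : ForcedTower) (i : ℕ) : Prop :=
  (3 : WithBot ℕ∞) ≤ ringKrullDim ((T.St i).presheaf.stalk (T.pt i))

/-- **the tower passes through a DEEP STAGE**: some stage `j` is a principal weak-contact point of weight `n` of depth `≥ 2n`
followed by a stage of ring dimension `≥ 3` (LAW A's cell), or of depth `≥ 2n − 1` followed by a stage of ring dimension `≥ 4`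
(LAW B's cell) — the cell the depth laws EMPTY; at `n = 2` it contains g25's `DoublePointTower`. -/
def DeepTower (n : ℕ) (T : ForcedTower) : Prop :=
  ∃ j : ℕ, (DeepPointAt n (2 * n) (T.D j).ideal (T.pt j) ∧ DimThreeAt T (j + 1)) ∨
    (DeepPointAt n (2 * n - 1) (T.D j).ideal (T.pt j) ∧ DimFourAt T (j + 1))

/-- **g25's double point IS the depth-3 weight-2 point** (definitional). [folklore] -/
theorem doublePointAt_iff_deepPointAt {Y : Scheme.{0}} (I : Y.IdealSheafData) (y : Y) :
    DoublePointAt I y ↔ DeepPointAt 2 3 I y := Iff.rfl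

/-- depth is monotone. [folklore] -/
theorem deepPointAt_mono {Y : Scheme.{0}} {w N N' : ℕ} (h : N ≤ N') {I : Y.IdealSheafData} {y : Y}
    (hD : DeepPointAt w N' I y) : DeepPointAt w N I y := by
  obtain ⟨f, hf, hIf, z, hz1, hz2, c, hc, hfz⟩ := hD
  exact ⟨f, hf, hIf, z, hz1, hz2, c, hc, Ideal.pow_le_pow_right h hfz⟩

/-- a deep point is a weak-contact point (`N ≥ w + 1`). [folklore] -/
theorem weakContactAt_of_deepPointAt {Y : Scheme.{0}} {w N : ℕ} (h : w + 1 ≤ N) {I : Y.IdealSheafData} {y : Y}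
    (hD : DeepPointAt w N I y) : WeakContactAt w I y := by
  obtain ⟨f, hf, -, z, hz1, hz2, c, hc, hfz⟩ := hD
  exact ⟨z, hz1, hz2, f, hf, c, hc, Ideal.pow_le_pow_right h hfz⟩

/-- ring dimension ≥ 4 ⇒ ≥ 3. [folklore] -/
theorem dimThreeAt_of_dimFourAt (T : ForcedTower) (i : ℕ) (h : DimFourAt T i) : DimThreeAt T i :=
  le_trans (by exact_mod_cast (by norm_num : (3 : ℕ) ≤ 4)) h

/-- **THE DEPTH LAWS ALONG FORCED TOWERS (KERNEL, PROVED — every field, every characteristic, every weight `n ≥ 1`): A DEEP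
POINT HAS NO SUCCESSOR.**  In a forced point tower of weight `n`, no stage `j` is a principal weak-contact point of
depth `N` with
(`N ≥ 2n` and `dim 𝒪_{x_{j+1}} ≥ 3`) or (`N ≥ 2n − 1 ≥ n + 1` and `dim 𝒪_{x_{j+1}} ≥ 4`): the marked point `x_{j+1}`
would have a
proper generization in `Sing(𝓘_{j+1}, n)` (`exists_generization_of_deepPoint`), contradicting `ForcedTower.isolated (j+1)`.
(Sources: the height counts §71; setting Hauser2010Kangaroo, Moh1987.) -/
theorem no_successor_of_deepPointAt (T : ForcedTower) (g : T.St 0 ⟶ Spec (.of k)) (hB : IsBase (T.St 0) g)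
    {n : ℕ} (hD : IsDatum n (T.D 0)) (hn : 1 ≤ n) (j : ℕ) {N : ℕ} (hN : n + 1 ≤ N)
    (h : DeepPointAt n N (T.D j).ideal (T.pt j))
    (hcase : (2 * n ≤ N ∧ DimThreeAt T (j + 1)) ∨ (2 * n ≤ N + 1 ∧ DimFourAt T (j + 1))) : False := by
  obtain ⟨hNj, hRj⟩ := tower_isLocallyNoetherian_isRegular T g hB j
  obtain ⟨hNj1, hRj1⟩ := tower_isLocallyNoetherian_isRegular T g hB (j + 1)
  haveI := hNj
  haveI := hNj1
  haveI : IsNoetherian (T.St j) := tower_isNoetherian T g hB j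
  have hπ := T.isBlowup j
  have hy : (T.π j).base (T.pt (j + 1)) = T.pt j := T.pt_map j
  have hDj1 : (T.D (j + 1)).ideal = controlledTransform (T.π j) (T.centre j) (T.D j).ideal n := by
    rw [T.transform_eq j, MarkedIdeal.transform_ideal, tower_mult_eq T hD j]
  have h' : DeepPointAt n N (T.D j).ideal ((T.π j).base (T.pt (j + 1))) := by rw [hy]; exact h
  obtain ⟨f, hfI, hIf, z, hz1, hz2, c, hc, hfz⟩ := h'
  -- spread the contact parameter to a germ ideal `H` with `H_x = (z)`
  have hz0 : z ≠ 0 := fun h0 => hz2 (by rw [h0]; exact zero_mem _)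
  have hspan : Ideal.span (Set.range fun _ : Fin 1 => z) = Ideal.span {z} := by rw [Set.range_const]
  obtain ⟨H, -, -, hHst⟩ := FInjectiveMacaulayfication.CentreSpread.centreSpread (T.St j) _ 1 (fun _ => z)
      (by rw [hspan, Ne, Ideal.span_singleton_eq_bot]; exact hz0)
      (by rw [hspan]; exact (Ideal.span_singleton_le_iff_mem _).mpr hz1)
  rw [hspan] at hHst
  have hpt' : ((T.centre j).support : Set (T.St j)) = {(T.π j).base (T.pt (j + 1))} := by
    rw [hy]; exact T.centre_support j
  have hcl : IsClosed ({(T.π j).base (T.pt (j + 1))} : Set (T.St j)) := by rw [hy]; exact T.isClosed_pt j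
  obtain ⟨ζ, hζ, hne, hζS⟩ := exists_generization_of_deepPoint hπ hRj hRj1 (T.centre_regular j) (T.D j).ideal H
    (T.pt (j + 1)) hcl hpt' hn hN hfI hIf hHst hz1 hz2 hc hfz hcase (T.D (j + 1)) hDj1 (tower_mult_eq T hD (j + 1))
    (T.isolated (j + 1)).1
  exact not_isIsolatedIn_of_specializes hζ hne hζS (T.isolated (j + 1))

/-- **COROLLARY (KERNEL, PROVED): NO FORCED TOWER OF WEIGHT `n ≥ 2` PASSES THROUGH A DEEP STAGE** — `¬ DeepTower n T` over every
field: the forced-tower DEPTH BOUND «`|r| + shade ≤ 2n − 1` before a threefold point, `≤ 2n − 2` before a fourfold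
point». [folklore] -/
theorem no_deepTower (T : ForcedTower) (g : T.St 0 ⟶ Spec (.of k)) (hB : IsBase (T.St 0) g) {n : ℕ}
    (hD : IsDatum n (T.D 0)) (hn : 2 ≤ n) : ¬ DeepTower n T := by
  rintro ⟨j, ⟨h, h3⟩ | ⟨h, h4⟩⟩
  · exact no_successor_of_deepPointAt T g hB hD (by omega) j (N := 2 * n) (by omega) h (Or.inl ⟨le_rfl, h3⟩)
  · exact no_successor_of_deepPointAt T g hB hD (by omega) j (N := 2 * n - 1) (by omega) h (Or.inr ⟨by omega, h4⟩)

/-- **g25's cell is the weight-two slice of the deep cell** (hypothesis-free). [folklore] -/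
theorem deepTower_of_doublePointTower (T : ForcedTower) (h : DoublePointTower T) : DeepTower 2 T := by
  obtain ⟨j, hdp, h4⟩ := h
  exact ⟨j, Or.inr ⟨(doublePointAt_iff_deepPointAt _ _).mp hdp, h4⟩⟩

/-- **g25 RE-DERIVED from the uniform law** (consistency check, hypothesis-free): no weight-two forced tower passes through a
double point with a dim-4 successor. [folklore] -/
theorem no_doublePointTower_of_depthLaw (T : ForcedTower) (g : T.St 0 ⟶ Spec (.of k)) (hB : IsBase (T.St 0) g)
    (hD : IsDatum 2 (T.D 0)) : ¬ DoublePointTower T := fun h =>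
  no_deepTower T g hB hD le_rfl (deepTower_of_doublePointTower T h)

end DepthTowers

end Summit.ResolutionOfSingularities.ResolutionOfSingularities.Theorems.HugValuationCut
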